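import Summits.QuantumFields.YangMills.Theorems.FemtoTransferGap
import Literature.MathematicalPhysics.QuantumLattice.SU2Haar
import Literature.MathematicalPhysics.QuantumFieldTheory.Balaban1983to89.StrongCouplingVarianceWindow

/-!
# The EXACT magnetic potential of the one-site `SU(2)` three-matrix model: `2 − Re tr(XYX⁻¹Y⁻¹) = 4|x × y|²`
# (support module for the registered stubs `stub_oneSiteEnergyLower/Upper` of crux `OneSiteLevels`, route `LuscherReduction`,
# item stmt-QuantumFields-20007; fleet lead prover ym-luscher-20007-p1)

The one-site (`L = 1`) transfer kernel of `Theorems.FemtoTransferGap` carries the magnetic weight `e^{−(B/2)(S(U)+S(V))}` with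
`S(U) = Σ_{i<j} (2 − Re tr(U_iU_jU_i⁻¹U_j⁻¹))` — at `L = 1` every plaquette holonomy is a group COMMUTATOR (`wilsonAction_one_site`).  Every
semiclassical step of the crux (harmonic/quartic approximation at the torons, large-field suppression off the valley of commuting triples,
the magnetic factor of trial states) needs this potential EXACTLY, not to leading order.  Writing a unit quaternion as
`U = quatMatrix q`, `q = su2Quat U = re + imI·i + imJ·j + imK·k` (the tree's quaternion model of `SU(2)`,
`Literature/MathematicalPhysics/QuantumLattice/SU2Haar.lean`: `U = [[z, w], [−w̄, z̄]]`, `z = re + imI·i`, `w = imJ + imK·i`, `|q| = 1`),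
the plaquette cost is the EXACT quartic in the imaginary (vector) parts `x = (imI, imJ, imK)(su2Quat X)`, `y` likewise:

  `2 − Re tr(XYX⁻¹Y⁻¹) = 4 |x × y|²`      (`two_sub_re_trace_comm_eq`, components written out)

(quaternion algebra: `scal(q p q* p*) = 1 − 2|x × y|²` for unit `q = (u₀,x)`, `p = (v₀,y)`; kernel-checked below by `linear_combination` with the
two unit-norm relations).  Consequences: the vector part has `|x|² = 1 − (Re tr X)²/4` (`su2Quat_imSq_eq`), so
`2 − Re tr(XYX⁻¹Y⁻¹) ≤ 4|x|²|y|² = 4(1 − (Re tr X)²/4)(1 − (Re tr Y)²/4) ≤ 4(2 − |Re tr X|)(2 − |Re tr Y|)` (`two_sub_re_trace_comm_le`,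
`two_sub_re_trace_comm_le_abs` — the TWIST-INVARIANT form, small near all 8 torons `U_k = ±1` at once), the valley (zero set) is
«`x ∥ y`», and near a toron `x ≈ c/2` recovers Lüscher's `¼|c_i × c_j|²` with relative error `O(c²)` (line card `Lines/energy-lower-abs.md` §5).
For the one-site Wilson action: `S(U) = Σ_p (2 − Re tr[U_i,U_j])` (`wilsonAction_one_site`) and
`S(U) ≤ 4 Σ_p (2 − |Re tr U_i|)(2 − |Re tr U_j|)` (`wilsonAction_one_site_le_abs`).

## WHAT THIS IS NOT
No statement about transfer values or `β → ∞`; NOT the crux, NOT THE CLAY GAP.  Sorry-free; no new definition, no named fact.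
-/

set_option autoImplicit false

noncomputable section

open Matrix
open scoped ComplexConjugate BigOperators
open Literature.MathematicalPhysics.QuantumFieldTheory
open Literature.MathematicalPhysics.QuantumLattice

namespace Summit.QuantumFields.YangMills.Theorems.FemtoTransferGap

/-! ### §1. The quaternion coordinates of an `SU(2)` matrix (tree model `su2Quat`, `quatMatrix`; unit norm `sq_sum_su2Quat`) -/

/-- `Re tr U = 2 re(su2Quat U)` (the trace of a unit quaternion matrix is twice its scalar part). [cite: BrockerTomDieck1985, I (1.10)] -/
theorem su2_trace_re_eq_quat (U : SU2) :
    ((U : Matrix (Fin 2) (Fin 2) ℂ).trace).re = 2 * (su2Quat U).re := by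
  rw [Matrix.trace_fin_two, su2_apply_11, Complex.add_re, Complex.conj_re]
  simp [su2Quat]
  ring

/-- **The vector part has squared length `1 − (Re tr U)²/4`**: `imI² + imJ² + imK² = 1 − (Re tr U)²/4`. [cite: BrockerTomDieck1985, I (1.10)] -/
theorem su2Quat_imSq_eq (U : SU2) :
    (su2Quat U).imI ^ 2 + (su2Quat U).imJ ^ 2 + (su2Quat U).imK ^ 2
      = 1 - ((U : Matrix (Fin 2) (Fin 2) ℂ).trace).re ^ 2 / 4 := by
  have h := Balaban1983to89.StrongCouplingVarianceWindow.sq_sum_su2Quat U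
  rw [su2_trace_re_eq_quat]
  nlinarith [h]

/-- The vector part is bounded by the twist-invariant distance to `±1`: `imI² + imJ² + imK² ≤ 2 − |Re tr U|`
(`1 − r² ≤ 2(1 − r)` for `r = |Re tr U|/2 ≤ 1`). [cite: BrockerTomDieck1985, I (1.10)] -/
theorem su2Quat_imSq_le_abs (U : SU2) :
    (su2Quat U).imI ^ 2 + (su2Quat U).imJ ^ 2 + (su2Quat U).imK ^ 2 ≤ 2 - |((U : Matrix (Fin 2) (Fin 2) ℂ).trace).re| := by
  rw [su2Quat_imSq_eq]
  have h := Balaban1983to89.StrongCouplingVarianceWindow.sq_sum_su2Quat U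
  have htr := su2_trace_re_eq_quat U
  set t := ((U : Matrix (Fin 2) (Fin 2) ℂ).trace).re with ht
  have hle : |t| ≤ 2 := by
    rw [htr, abs_mul, abs_of_pos (by norm_num : (0:ℝ) < 2)]
    have : |(su2Quat U).re| ≤ 1 := abs_le_one_iff_mul_self_le_one.mpr (by nlinarith [h])
    linarith
  have hsq : t ^ 2 = |t| ^ 2 := (sq_abs t).symm
  nlinarith [abs_nonneg t, hle, hsq]

/-- The vector part has non-negative squared length, so `0 ≤ 2 − |Re tr U|`. [cite: BrockerTomDieck1985, I (1.10)] -/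
theorem two_sub_abs_trace_re_nonneg (U : SU2) : 0 ≤ 2 - |((U : Matrix (Fin 2) (Fin 2) ℂ).trace).re| :=
  le_trans (by positivity) (su2Quat_imSq_le_abs U)

/-! ### §2. The exact commutator identity and its bounds -/

/-- **EXACT PLAQUETTE COST OF THE ONE-SITE MODEL**: for `X, Y ∈ SU(2)` with quaternion vector parts `x = (imI, imJ, imK)(su2Quat X)`,
`y` likewise, `2 − Re tr(X Y X⁻¹ Y⁻¹) = 4 |x × y|²` (the three components of `x × y` written out).  Quaternion algebra
(`scal(q p q̄ p̄) = 1 − 2|x × y|²` for unit quaternions), certified by `linear_combination` with the two unit-norm relations.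
[cite: Luscher1983, §2] -/
theorem two_sub_re_trace_comm_eq (X Y : SU2) :
    2 - (((X * Y * X⁻¹ * Y⁻¹ : SU2) : Matrix (Fin 2) (Fin 2) ℂ).trace).re
      = 4 * (((su2Quat X).imJ * (su2Quat Y).imK - (su2Quat X).imK * (su2Quat Y).imJ) ^ 2
            + ((su2Quat X).imK * (su2Quat Y).imI - (su2Quat X).imI * (su2Quat Y).imK) ^ 2
            + ((su2Quat X).imI * (su2Quat Y).imJ - (su2Quat X).imJ * (su2Quat Y).imI) ^ 2) := by
  have hX11 := su2_apply_11 X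
  have hX10 := su2_apply_10 X
  have hY11 := su2_apply_11 Y
  have hY10 := su2_apply_10 Y
  have hX := Balaban1983to89.StrongCouplingVarianceWindow.sq_sum_su2Quat X
  have hY := Balaban1983to89.StrongCouplingVarianceWindow.sq_sum_su2Quat Y
  simp only [su2Quat] at hX hY ⊢
  rw [← Matrix.star_eq_inv X, ← Matrix.star_eq_inv Y]
  rw [Submonoid.coe_mul, Submonoid.coe_mul, Submonoid.coe_mul, Matrix.specialUnitaryGroup.coe_star,
    Matrix.specialUnitaryGroup.coe_star]
  set a := (X : Matrix (Fin 2) (Fin 2) ℂ) 0 0 with ha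
  set b := (X : Matrix (Fin 2) (Fin 2) ℂ) 0 1 with hb
  set c := (Y : Matrix (Fin 2) (Fin 2) ℂ) 0 0 with hc
  set d := (Y : Matrix (Fin 2) (Fin 2) ℂ) 0 1 with hd
  have hXs : star (X : Matrix (Fin 2) (Fin 2) ℂ) = !![conj a, -b; conj b, a] := by
    ext i j
    fin_cases i <;> fin_cases j <;> simp [Matrix.star_apply, hX11, hX10, ha, hb]
  have hYs : star (Y : Matrix (Fin 2) (Fin 2) ℂ) = !![conj c, -d; conj d, c] := by
    ext i j
    fin_cases i <;> fin_cases j <;> simp [Matrix.star_apply, hY11, hY10, hc, hd]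
  have hXm : (X : Matrix (Fin 2) (Fin 2) ℂ) = !![a, b; -conj b, conj a] := by
    rw [← hX11, ← hX10]; exact Matrix.eta_fin_two _
  have hYm : (Y : Matrix (Fin 2) (Fin 2) ℂ) = !![c, d; -conj d, conj c] := by
    rw [← hY11, ← hY10]; exact Matrix.eta_fin_two _
  rw [hXs, hYs, hXm, hYm]
  simp only [Matrix.mul_fin_two, Matrix.trace_fin_two_of]
  simp only [Complex.add_re, Complex.mul_re, Complex.mul_im, Complex.add_im,
    Complex.neg_re, Complex.neg_im, Complex.conj_re, Complex.conj_im]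
  linear_combination (-2 * (c.re ^ 2 + c.im ^ 2 + d.re ^ 2 + d.im ^ 2)) * hX + (-2) * hY

/-- Lagrange's inequality `|x × y|² ≤ |x|²|y|²` in components. [folklore] -/
theorem cross_sq_le_normSq_mul (x₁ x₂ x₃ y₁ y₂ y₃ : ℝ) :
    (x₂ * y₃ - x₃ * y₂) ^ 2 + (x₃ * y₁ - x₁ * y₃) ^ 2 + (x₁ * y₂ - x₂ * y₁) ^ 2
      ≤ (x₁ ^ 2 + x₂ ^ 2 + x₃ ^ 2) * (y₁ ^ 2 + y₂ ^ 2 + y₃ ^ 2) := by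
  nlinarith [sq_nonneg (x₁ * y₁ + x₂ * y₂ + x₃ * y₃)]

/-- **The plaquette cost is at most `4|x|²|y|²`**, with `|x|² = 1 − (Re tr X)²/4`:
`2 − Re tr(XYX⁻¹Y⁻¹) ≤ 4 (1 − (Re tr X)²/4)(1 − (Re tr Y)²/4)`. [cite: Luscher1983, §2] -/
theorem two_sub_re_trace_comm_le (X Y : SU2) :
    2 - (((X * Y * X⁻¹ * Y⁻¹ : SU2) : Matrix (Fin 2) (Fin 2) ℂ).trace).re
      ≤ 4 * ((1 - ((X : Matrix (Fin 2) (Fin 2) ℂ).trace).re ^ 2 / 4) * (1 - ((Y : Matrix (Fin 2) (Fin 2) ℂ).trace).re ^ 2 / 4)) := by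
  rw [two_sub_re_trace_comm_eq, ← su2Quat_imSq_eq X, ← su2Quat_imSq_eq Y]
  refine mul_le_mul_of_nonneg_left ?_ (by norm_num)
  exact cross_sq_le_normSq_mul (su2Quat X).imI (su2Quat X).imJ (su2Quat X).imK
    (su2Quat Y).imI (su2Quat Y).imJ (su2Quat Y).imK

/-- **Twist-invariant magnetic bound**: `2 − Re tr(XYX⁻¹Y⁻¹) ≤ 4 (2 − |Re tr X|)(2 − |Re tr Y|)` — the cost is quadratically small near
every pair of centre elements `X, Y ∈ {±1}` simultaneously (the form needed for zero-flux trial states and cut-offs, which are functions of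
`|Re tr U_k|`). [cite: Luscher1983, §2] -/
theorem two_sub_re_trace_comm_le_abs (X Y : SU2) :
    2 - (((X * Y * X⁻¹ * Y⁻¹ : SU2) : Matrix (Fin 2) (Fin 2) ℂ).trace).re
      ≤ 4 * ((2 - |((X : Matrix (Fin 2) (Fin 2) ℂ).trace).re|) * (2 - |((Y : Matrix (Fin 2) (Fin 2) ℂ).trace).re|)) := by
  rw [two_sub_re_trace_comm_eq]
  refine mul_le_mul_of_nonneg_left ?_ (by norm_num)
  have hx := su2Quat_imSq_le_abs X
  have hy := su2Quat_imSq_le_abs Y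
  have h := cross_sq_le_normSq_mul (su2Quat X).imI (su2Quat X).imJ (su2Quat X).imK
    (su2Quat Y).imI (su2Quat Y).imJ (su2Quat Y).imK
  have hx0 : 0 ≤ (su2Quat X).imI ^ 2 + (su2Quat X).imJ ^ 2 + (su2Quat X).imK ^ 2 := by positivity
  have hy0 : 0 ≤ (su2Quat Y).imI ^ 2 + (su2Quat Y).imJ ^ 2 + (su2Quat Y).imK ^ 2 := by positivity
  exact h.trans (mul_le_mul hx hy hy0 (hx0.trans hx))

/-- The plaquette cost is non-negative: `Re tr(XYX⁻¹Y⁻¹) ≤ 2`. [cite: Luscher1983, §2] -/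
theorem re_trace_comm_le_two (X Y : SU2) :
    (((X * Y * X⁻¹ * Y⁻¹ : SU2) : Matrix (Fin 2) (Fin 2) ℂ).trace).re ≤ 2 := by
  have h := two_sub_re_trace_comm_eq X Y
  nlinarith [h, sq_nonneg ((su2Quat X).imJ * (su2Quat Y).imK - (su2Quat X).imK * (su2Quat Y).imJ),
    sq_nonneg ((su2Quat X).imK * (su2Quat Y).imI - (su2Quat X).imI * (su2Quat Y).imK),
    sq_nonneg ((su2Quat X).imI * (su2Quat Y).imJ - (su2Quat X).imJ * (su2Quat Y).imI)]

/-! ### §3. The one-site Wilson action -/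

/-- At `L = 1` the lattice shift is the identity (one site). [folklore] -/
theorem site_shift_one (x : Site 3 1) (i : Fin 3) : x.shift i = x := Subsingleton.elim _ _

/-- At `L = 1` every plaquette holonomy is a group commutator `U_i U_j U_i⁻¹ U_j⁻¹`. [cite: Luscher1983, §2] -/
theorem plaquetteHolonomy_one_site {G : Type*} [Group G] (U : GaugeConfig 3 1 G) (x : Site 3 1) (i j : Fin 3) :
    plaquetteHolonomy U x i j = U (x, i) * U (x, j) * (U (x, i))⁻¹ * (U (x, j))⁻¹ := by
  unfold plaquetteHolonomy
  rw [site_shift_one, site_shift_one]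

/-- **The one-site Wilson action is the sum of the three commutator costs**:
`S(U) = Σ_p (2 − Re tr(U_i U_j U_i⁻¹ U_j⁻¹))` over the plaquettes `p = (x, i<j)` of the one-site torus. [cite: Luscher1983, §2] -/
theorem wilsonAction_one_site (U : GaugeConfig 3 1 SU2) :
    wilsonAction su2Rep U = ∑ p : Plaquette 3 1,
      (2 - (((U (p.1, p.2.1.1) * U (p.1, p.2.1.2) * (U (p.1, p.2.1.1))⁻¹ * (U (p.1, p.2.1.2))⁻¹ : SU2) :
        Matrix (Fin 2) (Fin 2) ℂ).trace).re) := by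
  unfold wilsonAction
  refine Finset.sum_congr rfl fun p _ => ?_
  rw [plaquetteHolonomy_one_site, fundamentalRep_apply]
  norm_num

/-- **Twist-invariant bound on the one-site action**: `S(U) ≤ 4 Σ_p (2 − |Re tr U_i|)(2 − |Re tr U_j|)` — in particular
`S(U) ≤ 12 w²` wherever every link has `2 − |Re tr U_k| ≤ w` (the magnetic factor of centre-symmetric trial states and cut-offs).
[cite: Luscher1983, §2] -/
theorem wilsonAction_one_site_le_abs (U : GaugeConfig 3 1 SU2) :
    wilsonAction su2Rep U ≤ 4 * ∑ p : Plaquette 3 1,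
      (2 - |((U (p.1, p.2.1.1) : Matrix (Fin 2) (Fin 2) ℂ).trace).re|) *
        (2 - |((U (p.1, p.2.1.2) : Matrix (Fin 2) (Fin 2) ℂ).trace).re|) := by
  rw [wilsonAction_one_site, Finset.mul_sum]
  exact Finset.sum_le_sum fun p _ => two_sub_re_trace_comm_le_abs _ _

/-- Uniform version: if every link satisfies `2 − |Re tr U_k| ≤ w` (`0 ≤ w`), then `S(U) ≤ 12 w²` (three plaquettes). [cite: Luscher1983, §2] -/
theorem wilsonAction_one_site_le_of_forall (U : GaugeConfig 3 1 SU2) {w : ℝ} (hw : 0 ≤ w)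
    (h : ∀ e : Edge 3 1, 2 - |((U e : Matrix (Fin 2) (Fin 2) ℂ).trace).re| ≤ w) :
    wilsonAction su2Rep U ≤ 12 * w ^ 2 := by
  refine (wilsonAction_one_site_le_abs U).trans ?_
  have hnn : ∀ e : Edge 3 1, 0 ≤ 2 - |((U e : Matrix (Fin 2) (Fin 2) ℂ).trace).re| :=
    fun e => two_sub_abs_trace_re_nonneg (U e)
  have hle : ∑ p : Plaquette 3 1,
      (2 - |((U (p.1, p.2.1.1) : Matrix (Fin 2) (Fin 2) ℂ).trace).re|) *
        (2 - |((U (p.1, p.2.1.2) : Matrix (Fin 2) (Fin 2) ℂ).trace).re|) ≤ ∑ _p : Plaquette 3 1, w ^ 2 := by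
    refine Finset.sum_le_sum fun p _ => ?_
    rw [sq]
    exact mul_le_mul (h _) (h _) (hnn _) hw
  have hP : Fintype.card (Plaquette 3 1) = 3 := by
    have h1 : Fintype.card (Site 3 1) = 1 := Fintype.card_unique
    have h2 : Fintype.card {p : Fin 3 × Fin 3 // p.1 < p.2} = 3 := by decide
    rw [show Fintype.card (Plaquette 3 1) = Fintype.card (Site 3 1 × {p : Fin 3 × Fin 3 // p.1 < p.2}) from rfl,
      Fintype.card_prod, h1, h2]
  have hcard : ∑ _p : Plaquette 3 1, w ^ 2 = 3 * w ^ 2 := by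
    rw [Finset.sum_const, Finset.card_univ, hP, nsmul_eq_mul]
    norm_num
  linarith [hle, hcard]

end Summit.QuantumFields.YangMills.Theorems.FemtoTransferGap

end
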